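import Literature.MathematicalPhysics.QuantumFieldTheory.ConformalBootstrap3D.PointFunctionalQuad
import Literature.MathematicalPhysics.QuantumFieldTheory.ConformalBootstrap3D.PointCertificateTableLower
import Literature.MathematicalPhysics.QuantumFieldTheory.ConformalBootstrap3D.PointCertificateTableUnboundedI

/-!
# Quadratic head cells in the lower-box table: two coefficient rules, `s`-pieces, sub-cells

The table form of rule (Q) (`PointFunctionalQuad`) as consumed by the kernel certificate theorems of
the LOWER boxes (twist-gap domain `j + τ ≤ E`, `boxExcluded_of_pointRules_twistI`):

* `headQuadNumberI` — the quadratic head-cell number with the INTERVAL coefficient bounds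
  `hrCoeffLo/Hi` (`hrCoeff_mem_Icc_interval`; cells strictly above the unitarity bound, e.g. the
  `ε`-row `Δ_ε < 1` at `ℓ = 0`), `headQuadI_sum_nonneg`; `headQuadNumber₂` selects monotone /
  interval by a bit, `blockPositive_pointFunctional_of_headQuad₂_Ico` is the cell rule at fixed `s`;
* `cell_of_headQuadNumber₂_pieces` — ONE head cell `[a, b)` of row `ℓ` from the certificate's global
  data ((M) termwise on the twist domain, (T) by the apex bracket), with the `s`-range cut into
  pieces `σ_0 = s_lo ≤ … ≤ σ_P = s_hi` (term grids per piece) and the cell cut into `m_i` uniform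
  coefficient sub-cells per piece: non-negative numbers for every (piece, sub-cell) give block
  positivity on `Q × [a, b)`;
* `boxExcluded_of_pointCells` — the two-row lower table with the head cells in SEMANTIC form
  (block positivity per cell, however obtained: corner / chord numbers through
  `cell_of_headNumber₂`, or quadratic numbers through `cell_of_headQuadNumber₂_pieces`), (O1) on
  `Q`, (M) termwise, (T) the apex bracket: `BoxExcluded Q`.

[cite: HogervorstRychkov2013, §3 eq. (3.9)]
-/

noncomputable section

namespace Literature.MathematicalPhysics.QuantumFieldTheory.ConformalBootstrap3D

open Finset Set

/-! ### Interval coefficient rule -/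

/-- The quadratic head-cell number with INTERVAL coefficient bounds
`A⁻_q = hrCoeffLo a b ℓ n j`, `A⁺_q = hrCoeffHi a b ℓ n j`:
`boxLB(Σ_q A⁻_q G_q) + Σ_q (A⁺_q - A⁻_q) min(boxLB G_q, 0)`. [cite: HogervorstRychkov2013, §3 eq. (3.9)] -/
def headQuadNumberI (ℓ : ℕ) (a b : ℝ) (F : Finset (ℕ × ℕ)) (G : ℕ × ℕ → ℕ → ℕ → ℝ) : ℝ :=
  boxLB (fun i j => ∑ q ∈ F, hrCoeffLo a b ℓ q.1 q.2 * G q i j)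
    + ∑ q ∈ F, (hrCoeffHi a b ℓ q.1 q.2 - hrCoeffLo a b ℓ q.1 q.2) * min (boxLB (G q)) 0

/-- **The head sum from ONE number, interval coefficients.** Cell start strictly above the
unitarity bound. [cite: HogervorstRychkov2013, §3 eq. (3.9)] -/
theorem headQuadI_sum_nonneg {ℓ : ℕ} {a b Δ θ η : ℝ} (ha : unitarityBound3D ℓ < a) (hΔ : Δ ∈ Icc a b)
    (hθ : θ ∈ Icc (0 : ℝ) 1) (hη : η ∈ Icc (0 : ℝ) 1) (F : Finset (ℕ × ℕ))
    (G : ℕ × ℕ → ℕ → ℕ → ℝ) (T : ℕ × ℕ → ℝ) (hG : ∀ q ∈ F, biquadEval (G q) θ η ≤ T q)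
    (hnum : 0 ≤ headQuadNumberI ℓ a b F G) :
    0 ≤ ∑ q ∈ F, hrCoeff Δ ℓ q.1 q.2 * T q := by
  have hA := fun q : ℕ × ℕ => hrCoeff_mem_Icc_interval ha hΔ.1 hΔ.2 q.1 q.2
  refine sum_mul_nonneg_of_boxNumber hθ hη F G T (fun q => hrCoeff Δ ℓ q.1 q.2)
    (fun q => hrCoeffLo a b ℓ q.1 q.2) (fun q => hrCoeffHi a b ℓ q.1 q.2)
    (fun q _ => ⟨(hA q).2.1, (hA q).2.2⟩) (fun q _ => (hA q).1.trans (hA q).2.1) hG ?_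
  unfold headQuadNumberI at hnum
  exact hnum

/-- **Quadratic head cell rule, interval coefficients, regular points** (fixed `s`).
[cite: HogervorstRychkov2013, §3 eq. (3.9)] -/
theorem blockPositive_pointFunctional_of_headQuadI {N : ℕ} (w z zb : Fin N → ℝ)
    (hz : ∀ k, z k ∈ Ioo (0 : ℝ) 1) (hzb : ∀ k, zb k ∈ Ioo (0 : ℝ) 1) {ℓ : ℕ} {a b s : ℝ}
    (ha : unitarityBound3D ℓ < a) (F : Finset (ℕ × ℕ)) (G : ℕ × ℕ → ℕ → ℕ → ℝ)
    (hG : ∀ Δ ∈ Icc a b, ∃ θ ∈ Icc (0 : ℝ) 1, ∃ η ∈ Icc (0 : ℝ) 1, ∀ q ∈ F,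
      biquadEval (G q) θ η ≤ pointFunctional w z zb (crossF s (-1) (zMono (Δ + (q.1 : ℝ)) q.2)))
    (hhead : 0 ≤ headQuadNumberI ℓ a b F G)
    (htail : ∀ q : ℕ × ℕ, q ∉ F → InDescendantRange ℓ q.1 q.2 →
      ∀ E ∈ Icc (a + q.1) (b + q.1), 0 ≤ pointFunctional w z zb (crossF s (-1) (zMono E q.2))) :
    ∀ Δ ∈ Icc a b, IsRegularPoint3D Δ ℓ → BlockPositive (pointFunctional w z zb) s Δ ℓ := by
  intro Δ hΔ hreg
  have hlt : unitarityBound3D ℓ < Δ := lt_of_lt_of_le ha hΔ.1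
  refine blockPositive_pointFunctional_of_termwise w z zb hz hzb hlt hreg.2 F ?_ ?_
  · obtain ⟨θ, hθ, η, hη, hGq⟩ := hG Δ hΔ
    have hsum := headQuadI_sum_nonneg ha hΔ hθ hη F G
      (fun q => pointFunctional w z zb (crossF s (-1) (zMono (Δ + (q.1 : ℝ)) q.2))) hGq hhead
    have hrw : ∑ q ∈ F, hrCoeff Δ ℓ q.1 q.2 / legendreLam ℓ *
        pointFunctional w z zb (crossF s (-1) (zMono (Δ + (q.1 : ℝ)) q.2)) =
        (1 / legendreLam ℓ) * ∑ q ∈ F, hrCoeff Δ ℓ q.1 q.2 *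
          pointFunctional w z zb (crossF s (-1) (zMono (Δ + (q.1 : ℝ)) q.2)) := by
      rw [Finset.mul_sum]; exact Finset.sum_congr rfl (fun q _ => by ring)
    rw [hrw]
    have hlam : 0 < legendreLam ℓ := legendreLam_pos ℓ
    exact mul_nonneg (by positivity) hsum
  · intro q hq hr
    exact htail q hq hr (Δ + (q.1 : ℝ)) ⟨by linarith [hΔ.1], by linarith [hΔ.2]⟩

/-- **Quadratic head cell rule, interval coefficients, half-open cell** (fixed `s`).
[cite: HogervorstRychkov2013, §3 eq. (3.9)] -/
theorem blockPositive_pointFunctional_of_headQuadI_Ico {N : ℕ} (w z zb : Fin N → ℝ)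
    (hz : ∀ k, z k ∈ Ioo (0 : ℝ) 1) (hzb : ∀ k, zb k ∈ Ioo (0 : ℝ) 1) {ℓ : ℕ} {a b s : ℝ}
    (ha : unitarityBound3D ℓ < a) (F : Finset (ℕ × ℕ)) (G : ℕ × ℕ → ℕ → ℕ → ℝ)
    (hG : ∀ Δ ∈ Icc a b, ∃ θ ∈ Icc (0 : ℝ) 1, ∃ η ∈ Icc (0 : ℝ) 1, ∀ q ∈ F,
      biquadEval (G q) θ η ≤ pointFunctional w z zb (crossF s (-1) (zMono (Δ + (q.1 : ℝ)) q.2)))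
    (hhead : 0 ≤ headQuadNumberI ℓ a b F G)
    (htail : ∀ q : ℕ × ℕ, q ∉ F → InDescendantRange ℓ q.1 q.2 →
      ∀ E ∈ Icc (a + q.1) (b + q.1), 0 ≤ pointFunctional w z zb (crossF s (-1) (zMono E q.2))) :
    ∀ Δ ∈ Ico a b, BlockPositive (pointFunctional w z zb) s Δ ℓ := by
  intro Δ hΔ
  have hreg := blockPositive_pointFunctional_of_headQuadI w z zb hz hzb ha F G hG hhead htail
  by_cases hr : IsRegularPoint3D Δ ℓ
  · exact hreg Δ ⟨hΔ.1, hΔ.2.le⟩ hr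
  · have hbd : unitarityBound3D ℓ ≤ Δ := ha.le.trans hΔ.1
    refine blockPositive_of_eventually_right w z zb hz hzb s Δ ℓ hr ?_
    filter_upwards [eventually_isRegularPoint3D_nhdsGT_of_bound_le hbd, Ioo_mem_nhdsGT hΔ.2]
      with Δ' hΔ'reg hΔ'
    exact ⟨hΔ'reg, hreg Δ' ⟨hΔ.1.trans hΔ'.1.le, hΔ'.2.le⟩ hΔ'reg⟩

/-! ### Two coefficient rules by a bit -/

/-- The quadratic head-cell number with the coefficient rule selected by a bit: monotone
(`headQuadNumber`, cell start `≥ ℓ + 1`) or interval (`headQuadNumberI`, cell start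
`> unitarityBound3D ℓ`). [cite: HogervorstRychkov2013, §3 eq. (3.9)] -/
def headQuadNumber₂ (ℓ : ℕ) (a b : ℝ) (F : Finset (ℕ × ℕ)) (G : ℕ × ℕ → ℕ → ℕ → ℝ)
    (useInterval : Bool) : ℝ :=
  if useInterval then headQuadNumberI ℓ a b F G else headQuadNumber ℓ a b F G

/-- **Quadratic head cell rule with two coefficient rules, half-open cell** (fixed `s`).
[cite: HogervorstRychkov2013, §3 eq. (3.9)] -/
theorem blockPositive_pointFunctional_of_headQuad₂_Ico {N : ℕ} (w z zb : Fin N → ℝ)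
    (hz : ∀ k, z k ∈ Ioo (0 : ℝ) 1) (hzb : ∀ k, zb k ∈ Ioo (0 : ℝ) 1) {ℓ : ℕ} {a b s : ℝ}
    (useInterval : Bool) (h1 : useInterval = false → (ℓ : ℝ) + 1 ≤ a)
    (h2 : useInterval = true → unitarityBound3D ℓ < a)
    (F : Finset (ℕ × ℕ)) (G : ℕ × ℕ → ℕ → ℕ → ℝ)
    (hG : ∀ Δ ∈ Icc a b, ∃ θ ∈ Icc (0 : ℝ) 1, ∃ η ∈ Icc (0 : ℝ) 1, ∀ q ∈ F,
      biquadEval (G q) θ η ≤ pointFunctional w z zb (crossF s (-1) (zMono (Δ + (q.1 : ℝ)) q.2)))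
    (hhead : 0 ≤ headQuadNumber₂ ℓ a b F G useInterval)
    (htail : ∀ q : ℕ × ℕ, q ∉ F → InDescendantRange ℓ q.1 q.2 →
      ∀ E ∈ Icc (a + q.1) (b + q.1), 0 ≤ pointFunctional w z zb (crossF s (-1) (zMono E q.2))) :
    ∀ Δ ∈ Ico a b, BlockPositive (pointFunctional w z zb) s Δ ℓ := by
  cases useInterval with
  | true =>
    have hnum : 0 ≤ headQuadNumberI ℓ a b F G := by simpa [headQuadNumber₂] using hhead
    exact blockPositive_pointFunctional_of_headQuadI_Ico w z zb hz hzb (h2 rfl) F G hG hnum htail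
  | false =>
    have hnum : 0 ≤ headQuadNumber ℓ a b F G := by simpa [headQuadNumber₂] using hhead
    exact blockPositive_pointFunctional_of_headQuad_Ico w z zb hz hzb (h1 rfl) F G hG hnum htail

/-! ### One head cell from the certificate's global data: `s`-pieces and coefficient sub-cells -/

/-- The tail terms of a head cell on the twist domain from the certificate's rules: every term with
`E ≥ E₀`, `j + τ ≤ E`, `j ≤ E` is non-negative on `Q` ((M) below `E_T`, (T) from `E_T` on).
[cite: HogervorstRychkov2013, §3 eq. (3.6)] -/
theorem tail_nonneg_of_pointRules_twist {N : ℕ} (w z zb : Fin N → ℝ)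
    (hz : ∀ k, z k ∈ Ioo (0 : ℝ) 1) (hzb : ∀ k, zb k ∈ Ioo (0 : ℝ) 1) (hord : ∀ k, zb k ≤ z k)
    (apex : Fin N) (hapex : 0 ≤ w apex) (qd qr : Fin N → ℝ) (hqd : ∀ k, 0 < qd k ∧ qd k ≤ 1)
    (hqr : ∀ k, 0 < qr k ∧ qr k ≤ 1)
    (hdomd : ∀ k, z k * zb k ≤ qd k ^ 2 * (z apex * zb apex) ∧ z k ≤ qd k * z apex)
    (hdomr : ∀ k, (1 - z k) * (1 - zb k) ≤ qr k ^ 2 * (z apex * zb apex) ∧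
      1 - zb k ≤ qr k * z apex)
    {Q : Set (ℝ × ℝ)} {slo shi E₀ ET τ : ℝ} (hQ : ∀ p ∈ Q, slo ≤ p.1 ∧ p.1 ≤ shi)
    (hM : ∀ (j : ℕ) (E : ℝ), E₀ ≤ E → E < ET → (j : ℝ) + τ ≤ E → ∀ p ∈ Q,
      0 ≤ pointFunctional w z zb (crossF p.1 (-1) (zMono E j)))
    (hB : ∑ k ∈ univ.erase apex, |w k| * ((1 - z k) * (1 - zb k)) ^ slo * qd k ^ ET
          + ∑ k, |w k| * (z k * zb k) ^ slo * qr k ^ ET ≤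
          w apex * ((1 - z apex) * (1 - zb apex)) ^ shi) :
    ∀ (j : ℕ) (E : ℝ), E₀ ≤ E → (j : ℝ) + τ ≤ E → (j : ℝ) ≤ E → ∀ p ∈ Q,
      0 ≤ pointFunctional w z zb (crossF p.1 (-1) (zMono E j)) := by
  intro j E hE0 hjτ hjE p hp
  by_cases hET : E < ET
  · exact hM j E hE0 hET hjτ p hp
  · have hBs := apexIneq_of_box w z zb hz hzb apex hapex qd qr (fun k => (hqd k).1.le)
      (fun k => (hqr k).1.le) (hQ p hp) hB
    exact term_nonneg_of_apex w z zb hz hzb hord apex qd qr hqd hqr hdomd hdomr hBs hjE (not_lt.1 hET)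

/-- **One quadratic head cell from its numbers: `s`-pieces × coefficient sub-cells.** Row `ℓ`, cell
`[a, b)` with `a ≤ b`, head level `n_F` (`a + n_F + 1 ≥ E₀`), coefficient bit (monotone: `a ≥ ℓ + 1`;
interval: `a > unitarityBound3D ℓ` and `a ≥ ℓ + τ`), node ratios `≥ 1/2` for the cell width; the
`s`-range `[s_lo, s_hi]` cut into pieces `σ_0 = s_lo ≤ σ_1 ≤ … ≤ σ_P = s_hi` with node ratios
`≥ 1/2` for every piece width, and per piece `i` the cell cut into `m_i ≥ 1` uniform coefficient
sub-cells; the term grids are those of the piece and the whole cell, substituted to the sub-cell.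
If every (piece, sub-cell) number `headQuadNumber₂ ≥ 0`, and the tail terms are non-negative on the
twist domain (`tail_nonneg_of_pointRules_twist`), then `φ_p` is block-positive on `[a, b)` for every
`p ∈ Q`. [cite: HogervorstRychkov2013, §3 eq. (3.9)] -/
theorem cell_of_headQuadNumber₂_pieces {N : ℕ} (w z zb : Fin N → ℝ)
    (hz : ∀ k, z k ∈ Ioo (0 : ℝ) 1) (hzb : ∀ k, zb k ∈ Ioo (0 : ℝ) 1)
    {Q : Set (ℝ × ℝ)} {slo shi E₀ τ : ℝ} (hQ : ∀ p ∈ Q, slo ≤ p.1 ∧ p.1 ≤ shi) (hτ1 : τ ≤ 1)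
    (htail : ∀ (j : ℕ) (E : ℝ), E₀ ≤ E → (j : ℝ) + τ ≤ E → (j : ℝ) ≤ E → ∀ p ∈ Q,
      0 ≤ pointFunctional w z zb (crossF p.1 (-1) (zMono E j)))
    {ℓ : ℕ} {a b : ℝ} (hab : a ≤ b) (nF : ℕ) (hnF : E₀ ≤ a + ((nF : ℝ) + 1)) (useInterval : Bool)
    (h1 : useInterval = false → (ℓ : ℝ) + 1 ≤ a)
    (h2 : useInterval = true → unitarityBound3D ℓ < a ∧ (ℓ : ℝ) + τ ≤ a)
    (hρ : ∀ k, 1 / 2 ≤ (z k * zb k) ^ ((b - a) / 2) ∧ 1 / 2 ≤ ((1 - z k) * (1 - zb k)) ^ ((b - a) / 2))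
    (σ : ℕ → ℝ) (P : ℕ) (hP : 0 < P) (hσ0 : σ 0 = slo) (hσP : σ P = shi)
    (hr : ∀ i < P, ∀ k, 1 / 2 ≤ ((1 - z k) * (1 - zb k)) ^ (σ (i + 1) - σ i) ∧
      1 / 2 ≤ (z k * zb k) ^ (σ (i + 1) - σ i))
    (m : ℕ → ℕ) (hm : ∀ i < P, 0 < m i)
    (hnum : ∀ i < P, ∀ i' < m i, 0 ≤ headQuadNumber₂ ℓ (a + (i' : ℝ) / m i * (b - a))
      (a + ((i' : ℝ) / m i + 1 / m i) * (b - a)) (headSet ℓ nF)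
      (fun q => gridSubst (termQuadGrid w z zb q.2 (σ i) (σ (i + 1)) (a + q.1) (b + q.1))
        ((i' : ℝ) / m i) (1 / m i)) useInterval) :
    ∀ p ∈ Q, ∀ Δ ∈ Ico a b, BlockPositive (pointFunctional w z zb) p.1 Δ ℓ := by
  intro p hp Δ hΔ
  -- the piece of `s = p.1`
  obtain ⟨i, hi, hsi⟩ := exists_piece_Icc σ P hP p.1
    ⟨by rw [hσ0]; exact (hQ p hp).1, by rw [hσP]; exact (hQ p hp).2⟩
  have hmi := hm i hi
  have hmR : (0 : ℝ) < m i := by exact_mod_cast hmi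
  have hba : 0 ≤ b - a := sub_nonneg.2 hab
  -- the sub-cell of `Δ`
  set t : ℕ → ℝ := fun i' => a + (i' : ℝ) / m i * (b - a) with ht
  have ht0 : t 0 = a := by simp [ht]
  have htm : t (m i) = b := by
    simp only [ht]
    rw [div_self (ne_of_gt hmR)]; ring
  obtain ⟨i', hi', hΔi⟩ := exists_cell_Ico t (m i) Δ (by rw [ht0, htm]; exact hΔ)
  have hi1 : t (i' + 1) = a + ((i' : ℝ) / m i + 1 / m i) * (b - a) := by
    simp only [ht, Nat.cast_add, Nat.cast_one]; ring
  rw [hi1] at hΔi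
  have he₀ : (0 : ℝ) ≤ (i' : ℝ) / m i := by positivity
  have hc : (0 : ℝ) ≤ 1 / m i := by positivity
  have hec : (i' : ℝ) / m i + 1 / m i ≤ 1 := by
    rw [← add_div, div_le_one hmR]; exact_mod_cast hi'
  -- the sub-cell end points
  set a' : ℝ := a + (i' : ℝ) / m i * (b - a) with ha'
  set b' : ℝ := a + ((i' : ℝ) / m i + 1 / m i) * (b - a) with hb'
  have haa' : a ≤ a' := le_add_of_nonneg_right (mul_nonneg he₀ hba)
  have hb'b : b' ≤ b := by
    have : ((i' : ℝ) / m i + 1 / m i) * (b - a) ≤ 1 * (b - a) := mul_le_mul_of_nonneg_right hec hba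
    rw [hb']; linarith
  -- the bound below `a`
  have hbd : unitarityBound3D ℓ ≤ a := by
    cases hu : useInterval with
    | true => exact (h2 hu).1.le
    | false => exact (unitarityBound3D_le_add_one ℓ).trans (h1 hu)
  have haτ : (ℓ : ℝ) + τ ≤ a := by
    cases hu : useInterval with
    | true => exact (h2 hu).2
    | false => linarith [h1 hu]
  refine blockPositive_pointFunctional_of_headQuad₂_Ico w z zb hz hzb useInterval
    (fun hu => (h1 hu).trans haa') (fun hu => lt_of_lt_of_le (h2 hu).1 haa') (headSet ℓ nF)
    (fun q => gridSubst (termQuadGrid w z zb q.2 (σ i) (σ (i + 1)) (a + q.1) (b + q.1))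
      ((i' : ℝ) / m i) (1 / m i)) ?_ (hnum i hi i' hi') ?_ Δ hΔi
  · -- the grids at the common box point
    intro Δ' hΔ'
    obtain ⟨θ, hθ, hsθ⟩ := exists_boxCoord hsi
    obtain ⟨η', hη', hΔη⟩ := exists_boxCoord (slo := a') (shi := b') (s := Δ') hΔ'
    refine ⟨θ, hθ, η', hη', fun q _ => ?_⟩
    show biquadEval (gridSubst (termQuadGrid w z zb q.2 (σ i) (σ (i + 1)) (a + q.1) (b + q.1))
      ((i' : ℝ) / m i) (1 / m i)) θ η' ≤ _
    rw [biquadEval_gridSubst]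
    have hη : (i' : ℝ) / m i + 1 / m i * η' ∈ Icc (0 : ℝ) 1 :=
      ⟨add_nonneg he₀ (mul_nonneg hc hη'.1), by nlinarith [hη'.2, hc]⟩
    have hρ' : ∀ k, 1 / 2 ≤ (z k * zb k) ^ ((b + (q.1 : ℝ) - (a + q.1)) / 2) ∧
        1 / 2 ≤ ((1 - z k) * (1 - zb k)) ^ ((b + (q.1 : ℝ) - (a + q.1)) / 2) := by
      intro k; rw [show b + (q.1 : ℝ) - (a + q.1) = b - a by ring]; exact hρ k
    have := termQuadGrid_le w z zb hz hzb q.2 (hsi.1.trans hsi.2)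
      (by linarith : a + (q.1 : ℝ) ≤ b + q.1) (hr i hi) hρ' hθ hη
    have hE : a + (q.1 : ℝ) + ((i' : ℝ) / m i + 1 / m i * η') * (b + q.1 - (a + q.1)) = Δ' + q.1 := by
      rw [hΔη, ha', hb']; ring
    rwa [hE, ← hsθ] at this
  · -- the tail on the sub-cell
    intro q hq hrq E hE
    have hE0 : E₀ ≤ E := by
      have := headSet_off hnF q hq hrq
      linarith [hE.1]
    have hj : (q.2 : ℝ) ≤ (ℓ : ℝ) + q.1 := by exact_mod_cast hrq.2.1
    have hjτ : (q.2 : ℝ) + τ ≤ E := by linarith [hE.1]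
    have hjE : (q.2 : ℝ) ≤ E := by
      linarith [hE.1, natCast_add_half_le_unitarityBound3D ℓ]
    exact htail q.2 E hE0 hjτ hjE p hp

/-! ### The two-row lower table with semantic head cells -/

/-- **Two-row LOWER-box table with SEMANTIC head cells.** Nodes / apex / domination data as in
`boxExcluded_of_pointTable₂`; twist gap `τ ≤ 1`, `τ ≤ E₀`; the box `Q ⊆ [s_lo, s_hi] × ([ε_lo, ε_hi)
∪ [t_{0,0}, E₀))`; an `ε`-row `tε 0 = ε_lo, …, tε Kε = ε_hi`, the scalar row `t 0 0 ≤ 3, …,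
t 0 (K 0) = E₀` and for every even `0 < ℓ < L` (`E₀ ≤ L + 1`) a row from `ℓ + 1` to `E₀`, every
cell given as BLOCK POSITIVITY on `Q × [cell)` (from `cell_of_headNumber₂` or
`cell_of_headQuadNumber₂_pieces`); (O1) on `Q`; (M) termwise on the twist domain; (T) the apex
bracket. CONCLUSION: `BoxExcluded Q`. [cite: HogervorstRychkov2013, §3 eq. (3.6)] -/
theorem boxExcluded_of_pointCells {N : ℕ} {w z zb : Fin N → ℝ}
    (hz : ∀ k, z k ∈ Ioo (0 : ℝ) 1) (hzb : ∀ k, zb k ∈ Ioo (0 : ℝ) 1) (hord : ∀ k, zb k ≤ z k)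
    (apex : Fin N) (hapex : 0 ≤ w apex) (qd qr : Fin N → ℝ) (hqd : ∀ k, 0 < qd k ∧ qd k ≤ 1)
    (hqr : ∀ k, 0 < qr k ∧ qr k ≤ 1)
    (hdomd : ∀ k, z k * zb k ≤ qd k ^ 2 * (z apex * zb apex) ∧ z k ≤ qd k * z apex)
    (hdomr : ∀ k, (1 - z k) * (1 - zb k) ≤ qr k ^ 2 * (z apex * zb apex) ∧
      1 - zb k ≤ qr k * z apex)
    {Q : Set (ℝ × ℝ)} {slo shi εlo εhi E₀ ET τ : ℝ}
    (t : ℕ → ℕ → ℝ) (K : ℕ → ℕ) (tε : ℕ → ℝ) (Kε : ℕ)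
    (hQ : ∀ p ∈ Q, (slo ≤ p.1 ∧ p.1 ≤ shi) ∧
      ((εlo ≤ p.2 ∧ p.2 < εhi) ∨ (t 0 0 ≤ p.2 ∧ p.2 < E₀)))
    (L : ℕ) (hL : E₀ ≤ (L : ℝ) + 1) (hτ1 : τ ≤ 1) (hτ0 : τ ≤ E₀)
    -- (O1), on `Q` itself
    (hI : ∀ p ∈ Q, 0 < pointFunctional w z zb (crossF p.1 (-1) (fun _ _ => (1 : ℝ))))
    -- the rows
    (htε : tε 0 = εlo ∧ tε Kε = εhi)
    (ht0 : t 0 0 ≤ 3 ∧ t 0 (K 0) = E₀)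
    (htℓ : ∀ ℓ, Even ℓ → ℓ ≠ 0 → ℓ < L → t ℓ 0 = (ℓ : ℝ) + 1 ∧ t ℓ (K ℓ) = E₀)
    (hcellε : ∀ k < Kε, ∀ p ∈ Q,
      ∀ Δ ∈ Ico (tε k) (tε (k + 1)), BlockPositive (pointFunctional w z zb) p.1 Δ 0)
    (hcell : ∀ ℓ, (ℓ = 0 ∨ (Even ℓ ∧ ℓ < L)) → ∀ k < K ℓ, ∀ p ∈ Q,
      ∀ Δ ∈ Ico (t ℓ k) (t ℓ (k + 1)), BlockPositive (pointFunctional w z zb) p.1 Δ ℓ)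
    -- (M), termwise
    (hM : ∀ (j : ℕ) (E : ℝ), E₀ ≤ E → E < ET → (j : ℝ) + τ ≤ E → ∀ p ∈ Q,
      0 ≤ pointFunctional w z zb (crossF p.1 (-1) (zMono E j)))
    -- (T)
    (hB : ∑ k ∈ univ.erase apex, |w k| * ((1 - z k) * (1 - zb k)) ^ slo * qd k ^ ET
          + ∑ k, |w k| * (z k * zb k) ^ slo * qr k ^ ET ≤
          w apex * ((1 - z apex) * (1 - zb apex)) ^ shi) :
    BoxExcluded Q := by
  have hQ1 : ∀ p ∈ Q, slo ≤ p.1 ∧ p.1 ≤ shi := fun p hp => (hQ p hp).1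
  refine boxExcluded_of_pointRules_twistI hz hzb hord apex hapex qd qr hqd hqr hdomd hdomr hQ1 hτ1 hτ0
    hI ?_ ?_ ?_ hM hB
  · -- (O2): `Δ_ε` lies in the ε-row or in the scalar row
    intro p hp
    rcases (hQ p hp).2 with hε | h0
    · exact blockPositive_of_cells_Ico tε Kε hcellε p hp p.2 ⟨htε.1 ▸ hε.1, htε.2 ▸ hε.2⟩
    · exact blockPositive_of_cells_Ico (t 0) (K 0) (hcell 0 (Or.inl rfl)) p hp p.2
        ⟨h0.1, ht0.2 ▸ h0.2⟩
  · -- (O3)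
    exact scalar_nonneg_of_cells (t 0) (K 0) ht0.1 ht0.2 (hcell 0 (Or.inl rfl))
  · -- (O4)
    exact spinning_nonneg_of_cells L hL t K (fun ℓ hev hℓ hℓL => (htℓ ℓ hev hℓ hℓL).1.le)
      (fun ℓ hev hℓ hℓL => (htℓ ℓ hev hℓ hℓL).2)
      (fun ℓ hev hℓ hℓL => hcell ℓ (Or.inr ⟨hev, hℓL⟩))

end Literature.MathematicalPhysics.QuantumFieldTheory.ConformalBootstrap3D
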